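import Mathlib.MeasureTheory.Integral.CircleIntegral
import Literature.Geometry.Symplectic.PuncturedDiscClosedOneForm
import HarnessLib

/-!
# The wrapping number as a period: `∮_{|z| = r} β = 2πκ`

Topic `Literature/Geometry/Symplectic`; proofs file (layer "wrapping number", continued) of the
fact seat of `Literature.Geometry.Symplectic.mclean_divisorComplement_convex_four` (M. McLean,
*The growth rate of symplectic homology and affine varieties*, GAFA 22 (2012), Lemma 5.17),
continuing `PuncturedDiscClosedOneForm.lean`: there a smooth closed `1`-form `β` on a punctured
disc was written `β = κ dϑ + dh` with a unique real `κ` (McLean's wrapping number, p. 36).  Here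
`κ` is identified with the **period** of `β` over the circles `|z| = r` (Bott–Tu 1982, §I.4 /
Example 1.7: `∮ dϑ = 2π`, `∮ dh = 0`), which is how the wrapping number is compared with
global quantities (Stokes) later on:

* `integral_angular_circleMap` — `∫₀^{2π} dϑ(γ'(t)) dt = 2π` for `γ(t) = r e^{it}`, `r ≠ 0`;
* `integral_extDeriv_circleMap_eq_zero` — `∫₀^{2π} dh(γ'(t)) dt = 0` for a `0`-form `h` of
  class `C¹` on an open set containing the circle (fundamental theorem of calculus, `γ` closed);
* `integral_circleMap_eq_two_pi_mul` — hence `∫₀^{2π} β(γ'(t)) dt = 2πκ` whenever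
  `β = κ dϑ + dh` on the punctured disc `𝔻_δ ∖ {0}`, `0 < r < δ`;
* `exists_wrapping_period` — for `β` smooth and closed on `𝔻_δ ∖ {0}` there is `κ` with
  `∫₀^{2π} β(γ_r'(t)) dt = 2πκ` for **every** `r ∈ (0, δ)` (combine with
  `exists_eq_smul_angular_add_extDeriv`).

Line integrals of the real `1`-forms `β : ℂ → ℂ [⋀^Fin 1]→L[ℝ] ℝ` are written out as interval
integrals `∫ t in 0..2π, β (circleMap 0 r t) ![deriv (circleMap 0 r) t]` (Mathlib's `circleMap`,
`deriv_circleMap`).  Everything is proved; no definitions, no named facts (D-0026).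

## References

* M. McLean, *The growth rate of symplectic homology and affine varieties*, Geom. Funct. Anal. 22
  (2012), p. 36 (wrapping number). [Mclean2012]
* R. Bott, L. W. Tu, *Differential Forms in Algebraic Topology*, GTM 82 (1982), §I.1 Example 1.7,
  §I.4. [BottTu1982Forms]
-/

noncomputable section

open scoped Topology ContDiff Real
open Set Filter Complex ContinuousAlternatingMap Metric MeasureTheory intervalIntegral

namespace Literature.Geometry.Symplectic

/-! ### `∮ dϑ = 2π` -/

/-- On the circle `γ(t) = r e^{it}` the angular form evaluates to `1` on the velocity:
`dϑ_{γ(t)}(γ'(t)) = Im(γ(t)⁻¹ γ(t) i) = 1` (`r ≠ 0`). [folklore] -/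
theorem angular_circleMap_deriv {r : ℝ} (hr : r ≠ 0) (t : ℝ) :
    ofSubsingleton ℝ ℂ ℝ (0 : Fin 1)
        (imCLM.comp ((circleMap 0 r t)⁻¹ • (1 : ℂ →L[ℝ] ℂ))) ![deriv (circleMap 0 r) t] = 1 := by
  rw [deriv_circleMap]
  change ((circleMap 0 r t)⁻¹ * (circleMap 0 r t * I)).im = 1
  rw [← mul_assoc, inv_mul_cancel₀ (circleMap_ne_center hr), one_mul, I_im]

/-- **`∮_{|z|=r} dϑ = 2π`** (`r ≠ 0`; Bott–Tu 1982, Example 1.7).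
[cite: BottTu1982Forms, §I.1 Example 1.7] -/
theorem integral_angular_circleMap {r : ℝ} (hr : r ≠ 0) :
    ∫ t in (0 : ℝ)..2 * π, ofSubsingleton ℝ ℂ ℝ (0 : Fin 1)
        (imCLM.comp ((circleMap 0 r t)⁻¹ • (1 : ℂ →L[ℝ] ℂ))) ![deriv (circleMap 0 r) t] =
      2 * π := by
  simp_rw [angular_circleMap_deriv hr]
  rw [intervalIntegral.integral_const, sub_zero, smul_eq_mul, mul_one]

/-! ### `∮ dh = 0` -/

/-- `d` of a `0`-form on one vector is the derivative of its scalar values: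
`dh_x(w) = D(y ↦ h(y)())(x)(w)`. [folklore] -/
theorem extDeriv_zeroForm_apply {h : ℂ → ℂ [⋀^Fin 0]→L[ℝ] ℝ} {x : ℂ}
    (hh : DifferentiableAt ℝ h x) (w : ℂ) :
    extDeriv h x ![w] = fderiv ℝ (fun y ↦ h y ![]) x w := by
  have h0 : Fin.removeNth (0 : Fin 1) ![w] = ![] := Subsingleton.elim _ _
  rw [extDeriv_apply hh]
  simp only [Fin.sum_univ_succ, Finset.univ_eq_empty, Finset.sum_empty, add_zero, Fin.val_zero,
    pow_zero, one_smul, Matrix.cons_val_zero, h0]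

/-- **`∮_{|z|=r} dh = 0`**: for a `0`-form `h` of class `C¹` on an open set `O` containing the
circle of radius `r`, `∫₀^{2π} dh_{γ(t)}(γ'(t)) dt = 0` (`γ` is closed; fundamental theorem of
calculus). [folklore] -/
theorem integral_extDeriv_circleMap_eq_zero {O : Set ℂ} (hO : IsOpen O)
    {h : ℂ → ℂ [⋀^Fin 0]→L[ℝ] ℝ} (hh : ContDiffOn ℝ 1 h O) {r : ℝ}
    (hγ : ∀ t, circleMap 0 r t ∈ O) :
    ∫ t in (0 : ℝ)..2 * π, extDeriv h (circleMap 0 r t) ![deriv (circleMap 0 r) t] = 0 := by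
  set f : ℂ → ℝ := fun y ↦ h y ![] with hf
  set g : ℝ → ℝ := fun t ↦ f (circleMap 0 r t) with hg
  have hdiff : ∀ t, DifferentiableAt ℝ h (circleMap 0 r t) := fun t ↦
    (hh.differentiableOn one_ne_zero).differentiableAt (hO.mem_nhds (hγ t))
  have hfd : ∀ t, HasFDerivAt f (fderiv ℝ f (circleMap 0 r t)) (circleMap 0 r t) := fun t ↦
    ((hdiff t).continuousAlternatingMap_apply_const _).hasFDerivAt
  -- `g' t = dh_{γ t}(γ' t)`
  have hgd : ∀ t, HasDerivAt g (extDeriv h (circleMap 0 r t) ![deriv (circleMap 0 r) t]) t := by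
    intro t
    rw [extDeriv_zeroForm_apply (hdiff t), deriv_circleMap]
    exact (hfd t).comp_hasDerivAt t (hasDerivAt_circleMap 0 r t)
  -- continuity of the integrand
  have hcont : Continuous fun t ↦ extDeriv h (circleMap 0 r t) ![deriv (circleMap 0 r) t] := by
    have h1 : ContinuousOn (fderiv ℝ h) O := hh.continuousOn_fderiv_of_isOpen hO le_rfl
    have h2 : Continuous fun t ↦ fderiv ℝ h (circleMap 0 r t) :=
      h1.comp_continuous (continuous_circleMap 0 r) hγ
    have h3 : Continuous fun t ↦ (fderiv ℝ h (circleMap 0 r t)) (circleMap 0 r t * I) :=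
      h2.clm_apply ((continuous_circleMap 0 r).mul continuous_const)
    have h4 : Continuous fun t ↦ (fderiv ℝ h (circleMap 0 r t)) (circleMap 0 r t * I) ![] :=
      (ContinuousAlternatingMap.apply ℝ ℂ ℝ (![] : Fin 0 → ℂ)).continuous.comp h3
    refine h4.congr fun t ↦ ?_
    rw [extDeriv_zeroForm_apply (hdiff t), deriv_circleMap,
      fderiv_continuousAlternatingMap_apply_const_apply (hdiff t)]
  rw [integral_eq_sub_of_hasDerivAt (fun t _ ↦ hgd t) (hcont.intervalIntegrable _ _)]
  have hper : g (2 * π) = g 0 := by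
    simp only [hg]
    rw [periodic_circleMap 0 r 0 |>.symm.trans (by rw [zero_add])]
  rw [hper, sub_self]

/-! ### The period of `κ dϑ + dh` -/

/-- **`∮_{|z|=r} (κ dϑ + dh) = 2πκ`**: if `β = κ dϑ + dh` on the punctured disc `𝔻_δ ∖ {0}`
with `h` of class `C¹` there, then for `0 < r < δ` the period of `β` over the circle of radius
`r` is `2πκ` (McLean's wrapping number `κ` is `(2π)⁻¹ ∮ θ` over a small meridian, up to the
model term). [cite: Mclean2012, p. 36 (wrapping number)] -/
theorem integral_circleMap_eq_two_pi_mul {δ r κ : ℝ} {β : ℂ → ℂ [⋀^Fin 1]→L[ℝ] ℝ}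
    {h : ℂ → ℂ [⋀^Fin 0]→L[ℝ] ℝ} (hr : 0 < r) (hrδ : r < δ)
    (hh : ContDiffOn ℝ 1 h (ball (0 : ℂ) δ \ {0}))
    (hβ : ∀ x ∈ ball (0 : ℂ) δ \ {0}, β x =
      κ • ofSubsingleton ℝ ℂ ℝ (0 : Fin 1) (imCLM.comp (x⁻¹ • (1 : ℂ →L[ℝ] ℂ))) + extDeriv h x) :
    ∫ t in (0 : ℝ)..2 * π, β (circleMap 0 r t) ![deriv (circleMap 0 r) t] = 2 * π * κ := by
  have hγ : ∀ t, circleMap 0 r t ∈ ball (0 : ℂ) δ \ {0} := fun t ↦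
    ⟨by rw [Metric.mem_ball, dist_zero_right, norm_circleMap_zero, abs_of_pos hr]; exact hrδ,
      circleMap_ne_center hr.ne'⟩
  have hrw : ∀ t, β (circleMap 0 r t) ![deriv (circleMap 0 r) t] =
      κ * 1 + extDeriv h (circleMap 0 r t) ![deriv (circleMap 0 r) t] := fun t ↦ by
    rw [hβ _ (hγ t), ContinuousAlternatingMap.add_apply, ContinuousAlternatingMap.smul_apply,
      angular_circleMap_deriv hr.ne', smul_eq_mul]
  simp_rw [hrw]
  have hO : IsOpen (ball (0 : ℂ) δ \ {0}) := isOpen_ball.sdiff isClosed_singleton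
  have hint : IntervalIntegrable (fun t ↦ extDeriv h (circleMap 0 r t) ![deriv (circleMap 0 r) t])
      volume 0 (2 * π) := by
    -- continuity, as in `integral_extDeriv_circleMap_eq_zero`
    have hdiff : ∀ t, DifferentiableAt ℝ h (circleMap 0 r t) := fun t ↦
      (hh.differentiableOn one_ne_zero).differentiableAt (hO.mem_nhds (hγ t))
    have h1 : ContinuousOn (fderiv ℝ h) (ball (0 : ℂ) δ \ {0}) :=
      hh.continuousOn_fderiv_of_isOpen hO le_rfl
    have h2 : Continuous fun t ↦ fderiv ℝ h (circleMap 0 r t) :=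
      h1.comp_continuous (continuous_circleMap 0 r) hγ
    have h3 : Continuous fun t ↦ (fderiv ℝ h (circleMap 0 r t)) (circleMap 0 r t * I) :=
      h2.clm_apply ((continuous_circleMap 0 r).mul continuous_const)
    have h4 : Continuous fun t ↦ (fderiv ℝ h (circleMap 0 r t)) (circleMap 0 r t * I) ![] :=
      (ContinuousAlternatingMap.apply ℝ ℂ ℝ (![] : Fin 0 → ℂ)).continuous.comp h3
    refine (h4.congr fun t ↦ ?_).intervalIntegrable _ _
    rw [extDeriv_zeroForm_apply (hdiff t), deriv_circleMap,
      fderiv_continuousAlternatingMap_apply_const_apply (hdiff t)]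
  rw [intervalIntegral.integral_add intervalIntegrable_const hint,
    integral_extDeriv_circleMap_eq_zero hO hh hγ, intervalIntegral.integral_const]
  simp only [sub_zero, smul_eq_mul, mul_one, add_zero]

/-- **The wrapping number as a period** (McLean 2012, p. 36; `H¹_dR(𝔻 ∖ 0) = ℝ` detected by
`∮`): for a `1`-form `β` that is `C^∞` and closed on the punctured disc `𝔻_δ ∖ {0}` there is a
real `κ` such that `∮_{|z| = r} β = 2πκ` for every `0 < r < δ` — the periods do not depend on
the radius — and `β - κ dϑ` is exact there. [cite: Mclean2012, p. 36 (wrapping number)] -/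
theorem exists_wrapping_period {δ : ℝ} {β : ℂ → ℂ [⋀^Fin 1]→L[ℝ] ℝ}
    (hβ : ContDiffOn ℝ ∞ β (ball (0 : ℂ) δ \ {0}))
    (hd : ∀ x ∈ ball (0 : ℂ) δ \ {0}, extDeriv β x = 0) :
    ∃ κ : ℝ, (∀ r, 0 < r → r < δ →
        ∫ t in (0 : ℝ)..2 * π, β (circleMap 0 r t) ![deriv (circleMap 0 r) t] = 2 * π * κ) ∧
      ∃ h : ℂ → ℂ [⋀^Fin 0]→L[ℝ] ℝ, ContDiffOn ℝ ∞ h (ball (0 : ℂ) δ \ {0}) ∧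
        ∀ x ∈ ball (0 : ℂ) δ \ {0}, β x =
          κ • ofSubsingleton ℝ ℂ ℝ (0 : Fin 1) (imCLM.comp (x⁻¹ • (1 : ℂ →L[ℝ] ℂ))) +
            extDeriv h x := by
  obtain ⟨κ, h, hh, hβh⟩ := exists_eq_smul_angular_add_extDeriv hβ hd
  exact ⟨κ, fun r hr hrδ ↦ integral_circleMap_eq_two_pi_mul hr hrδ (hh.of_le (by simp)) hβh,
    h, hh, hβh⟩

end Literature.Geometry.Symplectic
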